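import Mathlib

/-!
# The annihilator of the base field under a non-trivial character trivial on it
  (Lemma N5.L4(iii), the `a = 1` Gauss sum: «`L = k_F`»)

Lemma N5.L4(iii) of `route/TIER5.md` §N5.11.4, case `a = 1`: «`Σ_{f ∈ k_F} ψ̄(fy) = q·[y ∈ L] − 1`
where `L := {z ∈ k_E : ψ̄(fz) = 1 for all f ∈ k_F}` is a `k_F`-subspace of `k_E` (closed under
addition and under `k_F`-scaling) with `k_F ⊂ L ≠ k_E` (`ψ̄|_{k_F} = 1`, `ψ̄ ≠ 1`); as
`dim_{k_F} k_E = 2`, `L = k_F`». Checked here for a field `F`, an `F`-vector space `E` of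
dimension `2` and a character `ψ : AddChar E ℂ`:

* `annihilator`: the set `L` as an `F`-submodule (`AddChar.map_add_eq_mul`, `smul_smul`);
* `eq_span_of_le_of_ne_top`: a proper subspace of a `2`-dimensional space containing a line
  is that line;
* `annihilator_eq_span`: if `ψ` is trivial on `F·e` (`e ≠ 0`) and non-trivial, then `L = F·e`;
* `sum_smul_eq`: the inner sum `Σ_{f ∈ F} ψ(f • y) = |F|` for `y ∈ L` and `0` otherwise
  (`AddChar.sum_eq_ite`), so `Σ_{f ∈ F^×} ψ(f • y) = |F|·[y ∈ L] − 1`.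

The outer sum over `k_E^×/k_F^×` and the value `G = q` stay prose.
Declaration per README §8(d): «uses an L-value-free non-vanishing device: NO».
-/

namespace Summit.Ventures.HodgeRepro2.T5CharacterAnnihilator

variable {F E : Type*} [Field F] [AddCommGroup E] [Module F E]

/-- `L = {y ∣ ψ(f • y) = 1 for all f ∈ F}` is an `F`-submodule of `E`. -/
def annihilator (ψ : AddChar E ℂ) : Submodule F E where
  carrier := {y | ∀ f : F, ψ (f • y) = 1}
  zero_mem' := fun f => by rw [smul_zero, AddChar.map_zero_eq_one]
  add_mem' := fun {y z} hy hz f => by rw [smul_add, AddChar.map_add_eq_mul, hy f, hz f, one_mul]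
  smul_mem' := fun c y hy f => by rw [smul_smul]; exact hy (f * c)

/-- Membership in the annihilator. -/
theorem mem_annihilator (ψ : AddChar E ℂ) (y : E) :
    y ∈ (annihilator ψ : Submodule F E) ↔ ∀ f : F, ψ (f • y) = 1 := Iff.rfl

/-- A proper subspace of a `2`-dimensional space containing the line `F·v` (`v ≠ 0`) is `F·v`. -/
theorem eq_span_of_le_of_ne_top (hdim : Module.finrank F E = 2) {v : E} (hv : v ≠ 0)
    {L : Submodule F E} (h1 : F ∙ v ≤ L) (hne : L ≠ ⊤) : L = F ∙ v := by
  haveI : FiniteDimensional F E := Module.finite_of_finrank_pos (by omega)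
  have hlt : Module.finrank F L < 2 := hdim ▸ Submodule.finrank_lt hne
  have hspan : Module.finrank F (F ∙ v) = 1 := finrank_span_singleton hv
  have hle : Module.finrank F (F ∙ v) ≤ Module.finrank F L := Submodule.finrank_mono h1
  exact (Submodule.eq_of_le_of_finrank_eq h1 (by omega)).symm

/-- If `ψ` is trivial on the line `F·e` (`e ≠ 0`) and non-trivial, its annihilator is exactly
`F·e` — the prose's «`L = k_F`». -/
theorem annihilator_eq_span (hdim : Module.finrank F E = 2) (ψ : AddChar E ℂ) {e : E}
    (he : e ≠ 0) (hψe : ∀ f : F, ψ (f • e) = 1) (hψ : ψ ≠ 1) :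
    (annihilator ψ : Submodule F E) = F ∙ e := by
  refine eq_span_of_le_of_ne_top hdim he ?_ ?_
  · rw [Submodule.span_singleton_le_iff_mem, mem_annihilator]
    exact hψe
  · intro htop
    apply hψ
    ext y
    have hy : y ∈ (annihilator ψ : Submodule F E) := htop ▸ Submodule.mem_top
    have := (mem_annihilator (F := F) ψ y).1 hy 1
    rwa [one_smul] at this

/-- The character `f ↦ ψ(f • y)` of `F`. -/
def smulChar (ψ : AddChar E ℂ) (y : E) : AddChar F ℂ where
  toFun f := ψ (f • y)
  map_zero_eq_one' := by rw [zero_smul, AddChar.map_zero_eq_one]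
  map_add_eq_mul' a b := by rw [add_smul, AddChar.map_add_eq_mul]

open scoped Classical in
/-- The inner sum of the `a = 1` Gauss-sum computation: `Σ_{f ∈ F} ψ(f • y) = |F|` if `y ∈ L`
and `0` otherwise. -/
theorem sum_smul_eq [Fintype F] (ψ : AddChar E ℂ) (y : E) :
    (∑ f : F, ψ (f • y)) =
      if y ∈ (annihilator ψ : Submodule F E) then (Fintype.card F : ℂ) else 0 := by
  have e : (∑ f : F, ψ (f • y)) = ∑ f : F, smulChar ψ y f := rfl
  rw [e, AddChar.sum_eq_ite]
  congr 1
  apply propext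
  rw [mem_annihilator]
  constructor
  · intro h f
    have := DFunLike.congr_fun h f
    simpa [smulChar] using this
  · intro h
    ext f
    simpa [smulChar] using h f

end Summit.Ventures.HodgeRepro2.T5CharacterAnnihilator
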